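import Summits.HubbardSuperconductivity.HubbardSuperconductivity.Theorems.KLProgrammeKLRegimeScaleZeroRecordPairRegistered
import Summits.HubbardSuperconductivity.HubbardSuperconductivity.Theorems.KLProgrammePerturbedFermiCurvePolarExactJets
import Summits.HubbardSuperconductivity.HubbardSuperconductivity.Theorems.KLProgrammePerturbedFermiCurveWindowJetsDefs
import Literature.MathematicalPhysics.QuantumLattice.HubbardFermiRadiusBandSmooth

/-!
# Route `KLProgramme`, crux K3 — ENGINE (stmt-HubbardSuperconductivity-20437), row (C) `stub_twoLeg_curvature`, the SCALE-0 PRIVATE PAIR of `hres′` FROM THE RECORD ROWS,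
# part 5: the free Fermi-point sizes come from `hcertA : KlwjCertA` — the record interface is {bS₁, bS₂, sS₃, sS₄} and four fits

Seat hubbard-kl-k3c5-p1 (g20).  The (C) closer of record `A24a1G14.stub_twoLeg_curvature_of_producers_guard hexZ hcertA hres′` already carries k3c3-p3's window-jet
certificate `hcertA : KlwjCertA := FreeBandPolarJets (-1.0875) (-0.1125) klwjTableA` (`u ∈ [1.829, 2.807]`, `|u′| ≤ 1.5`, `|u″| ≤ 21.12`, `|u‴| ≤ 225.9`, `|u⁗| ≤ 7241` on
`klWindowC ± 3/80`).  Through k3c3-p3's exact polar jets (`polarLp_exact_graded_jets`, `toLp_klFermiPoint_eq`, `perturbedFermiRadius_zero`) these give the sizes of the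
FREE Fermi-point map uniformly on `klWindowC` — so the `hD` input of parts 3/4 is discharged BY A HYPOTHESIS THE CLOSER ALREADY HAS:
* **`freeFermiPointLp_sizes_of_klwjCertA`** — `‖γ₀′‖ ≤ 3.19`, `‖γ₀″‖ ≤ 24.12`, `‖γ₀‴‖ ≤ 240`, `‖γ₀⁗‖ ≤ 7430` at every angle, `μ ∈ klWindowC`;
* **`twoLegRead_frameZero_registered_of_records_certA`** — the REGISTERED scale-`0` pair from `hcertA`, `hS12` (#22a k = 1, 2), `hSjet` (#22b k = 3, 4) and the fits
  `3.19·bS₁ + δ_A ≤ 2¹⁰`, `3.19²·bS₂ + 24.12·bS₁ + δ_A ≤ 2⁴`, `sS₃ + δ_A ≤ 2⁴`, `sS₄ + δ_A ≤ 2¹¹` (`δ_A = (1 + 3.19 + 24.12 + 240 + 7430)⁴/10⁷⁸`; at the #22a targets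
  `bS₁ = 0.16`, `bS₂ = 1.0` the k = 2 row reads `10.18 + 3.86 = 14.04 ≤ 16`);
* **`twoLegRead_frameZero_registered_klEngGQ_of_records_certA`** — the (C) closer's prefix form from `hcertA` + ONE pointwise record hypothesis in the four-number currency.
Proofs only; no definitions; nothing here asserts (C), any stub of 20437, K3 or superconductivity; `KlwjCertA` and the record rows are HYPOTHESES (kit certificates / records).
References: BGM 2006 §2.4 Lemma 2.1 (2.36)–(2.42) [cite: BenfattoGiulianiMastropietro2006].
-/

noncomputable section

namespace Summit.HubbardSuperconductivity.HubbardSuperconductivity.Theorems.KLRegimeSplit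

set_option linter.dupNamespace false -- summit = problem name (single-conjunct summit), D-0017

open Real Finset Complex Literature.MathematicalPhysics.QuantumLattice Literature.Probability.LatticeModels GrassmannAlgebra Matrix
open Literature.MathematicalPhysics.QuantumLattice.FermiRG Literature.Probability.LatticeModels.BattleFederbush
open Literature.MathematicalPhysics.QuantumLattice.BandSectorCounting
open Summit.HubbardSuperconductivity.HubbardSuperconductivity.Theorems.KLProgrammeLegKernels
open Summit.HubbardSuperconductivity.HubbardSuperconductivity.Theorems.TwoLegFourier
open Summit.HubbardSuperconductivity.HubbardSuperconductivity.Theorems.EngineV8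
open Summit.HubbardSuperconductivity.HubbardSuperconductivity.Theorems.PerturbedFermiCurve
open Summit.HubbardSuperconductivity.HubbardSuperconductivity.Theorems.DispersionFlow
open scoped Nat

variable {L M : ℕ} [NeZero L] [NeZero M] {μ U β : ℝ}

/-! ## §1 The free Fermi-point sizes on `klWindowC` FROM `KlwjCertA` (already a hypothesis of the (C) closer) -/

omit [NeZero L] [NeZero M] in
/-- **THE FREE CURVE'S SIZES FROM THE WINDOW-JET CERTIFICATE `KlwjCertA`** (`klwjTableA`: `u ≤ 2.807`, `|u′| ≤ 1.5`, `|u″| ≤ 21.12`, `|u‴| ≤ 225.9`, `|u⁗| ≤ 7241`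
on `[-87/80, -9/80] ⊇ klWindowC`) through the EXACT polar jets (`polarLp_exact_graded_jets`): `‖γ₀′‖ ≤ 3.19`, `‖γ₀″‖ ≤ 24.12`, `‖γ₀‴‖ ≤ 240`, `‖γ₀⁗‖ ≤ 7430`
(`√(1.5² + 2.807²) = 3.183…`, `√(23.927² + 3²) = 24.11…`, `√(230.4² + 66.17²) = 239.7…`, `√(7370.5² + 909.6²) = 7426.4…`). [cite: BenfattoGiulianiMastropietro2006, §2.4 Lemma 2.1 (2.40)] -/
theorem freeFermiPointLp_sizes_of_klwjCertA (hA : KlwjCertA) (hμ : μ ∈ klWindowC) (θ : ℝ) :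
    ‖iteratedDeriv 1 (fun θ : ℝ => (WithLp.toLp 2 (klFermiPoint μ 0 θ) : Momentum)) θ‖ ≤ (319 : ℝ) / 100 ∧
    ‖iteratedDeriv 2 (fun θ : ℝ => (WithLp.toLp 2 (klFermiPoint μ 0 θ) : Momentum)) θ‖ ≤ (2412 : ℝ) / 100 ∧
    ‖iteratedDeriv 3 (fun θ : ℝ => (WithLp.toLp 2 (klFermiPoint μ 0 θ) : Momentum)) θ‖ ≤ 240 ∧
    ‖iteratedDeriv 4 (fun θ : ℝ => (WithLp.toLp 2 (klFermiPoint μ 0 θ) : Momentum)) θ‖ ≤ 7430 := by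
  have hμ' : μ ∈ Set.Icc (-1.0875 : ℝ) (-0.1125) := by
    simp only [klWindowC, Set.mem_Icc] at hμ ⊢; constructor <;> linarith [hμ.1, hμ.2]
  have hμ4 : (-4 : ℝ) < μ := by simp only [klWindowC, Set.mem_Icc] at hμ; linarith [hμ.1]
  have hμ0 : μ < 0 := by simp only [klWindowC, Set.mem_Icc] at hμ; linarith [hμ.2]
  have hu : ContDiff ℝ 4 (bandFermiRadius μ) := Literature.MathematicalPhysics.QuantumLattice.contDiff_bandFermiRadius hμ4 hμ0
  have h0 : |bandFermiRadius μ θ| ≤ 2.807 := by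
    have h1 := FreeBandPolarJets.umin_le hA μ hμ' θ
    have h2 := FreeBandPolarJets.le_umax hA μ hμ' θ
    simp only [klwjTableA] at h1 h2
    rw [abs_of_nonneg (by linarith)]; exact h2
  have h1 : |deriv (bandFermiRadius μ) θ| ≤ 1.5 := by simpa only [klwjTableA] using FreeBandPolarJets.abs_deriv_le hA μ hμ' θ
  have h2 : |deriv (deriv (bandFermiRadius μ)) θ| ≤ 21.12 := by simpa only [klwjTableA] using FreeBandPolarJets.abs_deriv_two_le hA μ hμ' θ
  have h3 : |deriv (deriv (deriv (bandFermiRadius μ))) θ| ≤ 225.9 := by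
    simpa only [klwjTableA] using FreeBandPolarJets.abs_deriv_three_le hA μ hμ' θ
  have h4 : |deriv (deriv (deriv (deriv (bandFermiRadius μ)))) θ| ≤ 7241 := by
    simpa only [klwjTableA] using FreeBandPolarJets.abs_deriv_four_le hA μ hμ' θ
  have hfun : (fun θ : ℝ => (WithLp.toLp 2 (klFermiPoint μ 0 θ) : Momentum)) = fun t => (WithLp.toLp 2 (bandFermiRadius μ t • dir t) : EuclideanSpace ℝ (Fin 2)) := by
    rw [toLp_klFermiPoint_eq]
    have hδ : (fun p : Fin 2 → ℝ => -(0 : TrigPolyC4v).eval p) = 0 := by funext p; simp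
    funext t
    rw [hδ, perturbedFermiRadius_zero]
  obtain ⟨j1, j2, j3, j4⟩ := polarLp_exact_graded_jets hu h0 h1 h2 h3 h4
  rw [hfun]
  refine ⟨j1.trans ?_, j2.trans ?_, j3.trans ?_, j4.trans ?_⟩
  · exact (Real.sqrt_le_sqrt (by norm_num)).trans_eq (Real.sqrt_sq (by norm_num))
  · exact (Real.sqrt_le_sqrt (by norm_num)).trans_eq (Real.sqrt_sq (by norm_num))
  · exact (Real.sqrt_le_sqrt (by norm_num)).trans_eq (Real.sqrt_sq (by norm_num))
  · exact (Real.sqrt_le_sqrt (by norm_num)).trans_eq (Real.sqrt_sq (by norm_num))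

/-! ## §2 The REGISTERED scale-`0` pair given `KlwjCertA`: record currency {bS₁, bS₂, sS₃, sS₄} -/

/-- **THE REGISTERED SCALE-0 PAIR FROM `KlwjCertA`, THE #22a ROWS k = 1, 2, THE #22b ROWS k = 3, 4 AND FOUR NUMERIC FITS** — the curve sizes are no longer an input:
fits `3.19·bS₁ + δ_A ≤ 2¹⁰`, `3.19²·bS₂ + 24.12·bS₁ + δ_A ≤ 2⁴`, `sS₃ + δ_A ≤ 2⁴`, `sS₄ + δ_A ≤ 2¹¹`, `δ_A = (1 + 3.19 + 24.12 + 240 + 7430)⁴/10⁷⁸ < 10⁻⁶²`.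
[cite: BenfattoGiulianiMastropietro2006, §2.4 Lemma 2.1 (2.36)-(2.42)] -/
theorem twoLegRead_frameZero_registered_of_records_certA (P : SplitConsts) (R : RenConsts) (hA : KlwjCertA) (hβ : klBetaMin ≤ β) (hμ : μ ∈ klWindowC)
    (hU : 0 < U) (hUb : U ≤ klTailBookU) (hL : klEngL₃ β U ≤ L) (hM : klEngM₃ β U L ≤ M) {bS sS : ℕ → ℝ}
    (hS12 : ∀ k, 1 ≤ k → k ≤ 2 → ∀ (σ : Fin 2) (p₀ : GridPoint L (2 * (2 * M))), ∑ p₁ : GridPoint L (2 * (2 * M)),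
      (if p₁ = p₀ then (0 : ℝ) else
        Real.sqrt ((((p₁.2 - p₀.2) 0).valMinAbs.natAbs : ℝ) ^ 2 + (((p₁.2 - p₀.2) 1).valMinAbs.natAbs : ℝ) ^ 2) ^ k * ‖contr ℂ ((hubbardGridSub L M β (2 * (2 * M))).transpose * hubbardCovAboveCT L M β μ 0 0 klE0 *
                hubbardGridSub L M β (2 * (2 * M))) (((p₁, σ), 0) : GridLeg (GridPoint L (2 * (2 * M)))) ((p₀, σ), 1) *
              (contr ℂ ((hubbardGridSub L M β (2 * (2 * M))).transpose * hubbardCovAboveCT L M β μ 0 0 klE0 *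
                hubbardGridSub L M β (2 * (2 * M))) (((p₀, σ.rev), 0) : GridLeg (GridPoint L (2 * (2 * M)))) ((p₁, σ.rev), 1) *
                contr ℂ ((hubbardGridSub L M β (2 * (2 * M))).transpose * hubbardCovAboveCT L M β μ 0 0 klE0 *
                hubbardGridSub L M β (2 * (2 * M))) (((p₁, σ.rev), 0) : GridLeg (GridPoint L (2 * (2 * M)))) ((p₀, σ.rev), 1))‖) ≤
        bS k * (((2 * (2 * M) : ℕ) : ℝ) / β))
    (hSjet : ∀ k, 3 ≤ k → k ≤ 4 → ∀ θ : ℝ, |iteratedDeriv k (fun θ : ℝ => evalM (symInterp L (fun pp : TorusSite 2 L =>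
        (∑ σσ : Fin 2, ((selfEnergy L M β (ExteriorAlgebra.map (Matrix.toLin' (gridSubMatrix L M β
            (fun p : GridPoint L (2 * (2 * M)) => p.2) (fun p => gridTime β (2 * (2 * M)) p.1)))
          (∑ p' : GridPoint L (2 * (2 * M)), ∑ q' : GridPoint L (2 * (2 * M)), ∑ σ' : Fin 2,
          (if p' = q' then (0 : ℂ) else
            -((((U * (β / (2 * (2 * M) : ℕ)) : ℝ) : ℂ) ^ 2 *
              (contr ℂ ((hubbardGridSub L M β (2 * (2 * M))).transpose * hubbardCovAboveCT L M β μ 0 0 klE0 *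
                  hubbardGridSub L M β (2 * (2 * M))) (((q', σ'), 0) : GridLeg (GridPoint L (2 * (2 * M)))) ((p', σ'), 1) *
                (contr ℂ ((hubbardGridSub L M β (2 * (2 * M))).transpose * hubbardCovAboveCT L M β μ 0 0 klE0 *
                    hubbardGridSub L M β (2 * (2 * M))) (((p', σ'.rev), 0) : GridLeg (GridPoint L (2 * (2 * M)))) ((q', σ'.rev), 1) *
                  contr ℂ ((hubbardGridSub L M β (2 * (2 * M))).transpose * hubbardCovAboveCT L M β μ 0 0 klE0 *
                    hubbardGridSub L M β (2 * (2 * M))) (((q', σ'.rev), 0) : GridLeg (GridPoint L (2 * (2 * M)))) ((p', σ'.rev), 1)))))) •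
            (gen ℂ (((p', σ'), 0) : GridLeg (GridPoint L (2 * (2 * M)))) * gen ℂ (((q', σ'), 1) : GridLeg (GridPoint L (2 * (2 * M))))))) (omega0 M, pp) σσ).re +
        (selfEnergy L M β (ExteriorAlgebra.map (Matrix.toLin' (gridSubMatrix L M β
            (fun p : GridPoint L (2 * (2 * M)) => p.2) (fun p => gridTime β (2 * (2 * M)) p.1)))
          (∑ p' : GridPoint L (2 * (2 * M)), ∑ q' : GridPoint L (2 * (2 * M)), ∑ σ' : Fin 2,
          (if p' = q' then (0 : ℂ) else
            -((((U * (β / (2 * (2 * M) : ℕ)) : ℝ) : ℂ) ^ 2 *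
              (contr ℂ ((hubbardGridSub L M β (2 * (2 * M))).transpose * hubbardCovAboveCT L M β μ 0 0 klE0 *
                  hubbardGridSub L M β (2 * (2 * M))) (((q', σ'), 0) : GridLeg (GridPoint L (2 * (2 * M)))) ((p', σ'), 1) *
                (contr ℂ ((hubbardGridSub L M β (2 * (2 * M))).transpose * hubbardCovAboveCT L M β μ 0 0 klE0 *
                    hubbardGridSub L M β (2 * (2 * M))) (((p', σ'.rev), 0) : GridLeg (GridPoint L (2 * (2 * M)))) ((q', σ'.rev), 1) *
                  contr ℂ ((hubbardGridSub L M β (2 * (2 * M))).transpose * hubbardCovAboveCT L M β μ 0 0 klE0 *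
                    hubbardGridSub L M β (2 * (2 * M))) (((q', σ'.rev), 0) : GridLeg (GridPoint L (2 * (2 * M)))) ((p', σ'.rev), 1)))))) •
            (gen ℂ (((p', σ'), 0) : GridLeg (GridPoint L (2 * (2 * M)))) * gen ℂ (((q', σ'), 1) : GridLeg (GridPoint L (2 * (2 * M))))))) ((omega0 M).rev, pp) σσ).re)) / 4))
        (WithLp.toLp 2 (klFermiPoint μ 0 θ))) θ| ≤ sS k * U ^ 2)
    (hfit : bS 1 * ((319 : ℝ) / 100) + (1 + (319 : ℝ) / 100 + 2412 / 100 + 240 + 7430) ^ 4 / (10 : ℝ) ^ 78 ≤ (2 : ℝ) ^ 10 ∧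
        bS 2 * ((319 : ℝ) / 100) ^ 2 + bS 1 * ((2412 : ℝ) / 100) + (1 + (319 : ℝ) / 100 + 2412 / 100 + 240 + 7430) ^ 4 / (10 : ℝ) ^ 78 ≤ (2 : ℝ) ^ 4 ∧
        sS 3 + (1 + (319 : ℝ) / 100 + 2412 / 100 + 240 + 7430) ^ 4 / (10 : ℝ) ^ 78 ≤ (2 : ℝ) ^ 4 ∧ sS 4 + (1 + (319 : ℝ) / 100 + 2412 / 100 + 240 + 7430) ^ 4 / (10 : ℝ) ^ 78 ≤ (2 : ℝ) ^ 11) :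
    TwoLegReadJetBound L M klC4aJetC2 (klC4aJetC' P R) β U μ (klFlowFrameU L M β U μ 0) 0 ∧
      TwoLegReadOscAt L M (klReadOscC P R) β U μ (klFlowFrameU L M β U μ 0) 0 := by
  have hD := fun θ => freeFermiPointLp_sizes_of_klwjCertA (μ := μ) hA hμ θ
  refine twoLegRead_frameZero_registered_of_records (L := L) (M := M) P R hβ hμ hU hUb hL hM hS12 hSjet
    (D := fun i => if i = 1 then (319 : ℝ) / 100 else if i = 2 then (2412 : ℝ) / 100 else if i = 3 then 240 else 7430) (fun θ i hi1 hi4 => ?_) ?_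
  · interval_cases i
    · exact (hD θ).1
    · exact (hD θ).2.1
    · exact (hD θ).2.2.1
    · exact (hD θ).2.2.2
  · exact hfit

/-- **THE (C) CLOSER'S PREFIX FORM GIVEN `hcertA : KlwjCertA`** (a hypothesis the closer `…_guard hexZ hcertA hres′` already holds): from ONE pointwise record hypothesis
`hrec` carrying only the #22a rows k = 1, 2 (`bS₁, bS₂`), the #22b rows k = 3, 4 (`sS₃, sS₄`) and the four numeric fits, for EVERY `G`, `Q`, under the closer's literal
binders: `TwoLegReadJetBound L M klC4aJetC2 (klC4aJetC′ P R) β U μ (K₀) 0 ∧ TwoLegReadOscAt L M (klReadOscC P R) β U μ (K₀) 0`.  ⟹ the scale-`0` member of `hres′`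
has as residual EXACTLY the two kit record families and their fits. [cite: BenfattoGiulianiMastropietro2006, §2.4 Lemma 2.1 (2.36)-(2.42)] -/
theorem twoLegRead_frameZero_registered_klEngGQ_of_records_certA (G : GeoConsts) (Q : EngConsts) (hA : KlwjCertA)
    (hrec : ∀ (μ U β : ℝ) (L M : ℕ) [NeZero L] [NeZero M], μ ∈ klWindowC → 0 < U → U ≤ klTailBookU → klBetaMin ≤ β →
      klEngL₃ β U ≤ L → klEngM₃ β U L ≤ M →
      ∃ bS sS : ℕ → ℝ,
        (bS 1 * ((319 : ℝ) / 100) + (1 + (319 : ℝ) / 100 + 2412 / 100 + 240 + 7430) ^ 4 / (10 : ℝ) ^ 78 ≤ (2 : ℝ) ^ 10 ∧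
        bS 2 * ((319 : ℝ) / 100) ^ 2 + bS 1 * ((2412 : ℝ) / 100) + (1 + (319 : ℝ) / 100 + 2412 / 100 + 240 + 7430) ^ 4 / (10 : ℝ) ^ 78 ≤ (2 : ℝ) ^ 4 ∧
        sS 3 + (1 + (319 : ℝ) / 100 + 2412 / 100 + 240 + 7430) ^ 4 / (10 : ℝ) ^ 78 ≤ (2 : ℝ) ^ 4 ∧ sS 4 + (1 + (319 : ℝ) / 100 + 2412 / 100 + 240 + 7430) ^ 4 / (10 : ℝ) ^ 78 ≤ (2 : ℝ) ^ 11) ∧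
        (∀ k, 1 ≤ k → k ≤ 2 → ∀ (σ : Fin 2) (p₀ : GridPoint L (2 * (2 * M))), ∑ p₁ : GridPoint L (2 * (2 * M)),
          (if p₁ = p₀ then (0 : ℝ) else
            Real.sqrt ((((p₁.2 - p₀.2) 0).valMinAbs.natAbs : ℝ) ^ 2 + (((p₁.2 - p₀.2) 1).valMinAbs.natAbs : ℝ) ^ 2) ^ k * ‖contr ℂ ((hubbardGridSub L M β (2 * (2 * M))).transpose * hubbardCovAboveCT L M β μ 0 0 klE0 *
                    hubbardGridSub L M β (2 * (2 * M))) (((p₁, σ), 0) : GridLeg (GridPoint L (2 * (2 * M)))) ((p₀, σ), 1) *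
                  (contr ℂ ((hubbardGridSub L M β (2 * (2 * M))).transpose * hubbardCovAboveCT L M β μ 0 0 klE0 *
                    hubbardGridSub L M β (2 * (2 * M))) (((p₀, σ.rev), 0) : GridLeg (GridPoint L (2 * (2 * M)))) ((p₁, σ.rev), 1) *
                    contr ℂ ((hubbardGridSub L M β (2 * (2 * M))).transpose * hubbardCovAboveCT L M β μ 0 0 klE0 *
                    hubbardGridSub L M β (2 * (2 * M))) (((p₁, σ.rev), 0) : GridLeg (GridPoint L (2 * (2 * M)))) ((p₀, σ.rev), 1))‖) ≤
            bS k * (((2 * (2 * M) : ℕ) : ℝ) / β)) ∧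
        (∀ k, 3 ≤ k → k ≤ 4 → ∀ θ : ℝ, |iteratedDeriv k (fun θ : ℝ => evalM (symInterp L (fun pp : TorusSite 2 L =>
            (∑ σσ : Fin 2, ((selfEnergy L M β (ExteriorAlgebra.map (Matrix.toLin' (gridSubMatrix L M β
                (fun p : GridPoint L (2 * (2 * M)) => p.2) (fun p => gridTime β (2 * (2 * M)) p.1)))
              (∑ p' : GridPoint L (2 * (2 * M)), ∑ q' : GridPoint L (2 * (2 * M)), ∑ σ' : Fin 2,
              (if p' = q' then (0 : ℂ) else
                -((((U * (β / (2 * (2 * M) : ℕ)) : ℝ) : ℂ) ^ 2 *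
                  (contr ℂ ((hubbardGridSub L M β (2 * (2 * M))).transpose * hubbardCovAboveCT L M β μ 0 0 klE0 *
                      hubbardGridSub L M β (2 * (2 * M))) (((q', σ'), 0) : GridLeg (GridPoint L (2 * (2 * M)))) ((p', σ'), 1) *
                    (contr ℂ ((hubbardGridSub L M β (2 * (2 * M))).transpose * hubbardCovAboveCT L M β μ 0 0 klE0 *
                        hubbardGridSub L M β (2 * (2 * M))) (((p', σ'.rev), 0) : GridLeg (GridPoint L (2 * (2 * M)))) ((q', σ'.rev), 1) *
                      contr ℂ ((hubbardGridSub L M β (2 * (2 * M))).transpose * hubbardCovAboveCT L M β μ 0 0 klE0 *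
                        hubbardGridSub L M β (2 * (2 * M))) (((q', σ'.rev), 0) : GridLeg (GridPoint L (2 * (2 * M)))) ((p', σ'.rev), 1)))))) •
                (gen ℂ (((p', σ'), 0) : GridLeg (GridPoint L (2 * (2 * M)))) * gen ℂ (((q', σ'), 1) : GridLeg (GridPoint L (2 * (2 * M))))))) (omega0 M, pp) σσ).re +
            (selfEnergy L M β (ExteriorAlgebra.map (Matrix.toLin' (gridSubMatrix L M β
                (fun p : GridPoint L (2 * (2 * M)) => p.2) (fun p => gridTime β (2 * (2 * M)) p.1)))
              (∑ p' : GridPoint L (2 * (2 * M)), ∑ q' : GridPoint L (2 * (2 * M)), ∑ σ' : Fin 2,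
              (if p' = q' then (0 : ℂ) else
                -((((U * (β / (2 * (2 * M) : ℕ)) : ℝ) : ℂ) ^ 2 *
                  (contr ℂ ((hubbardGridSub L M β (2 * (2 * M))).transpose * hubbardCovAboveCT L M β μ 0 0 klE0 *
                      hubbardGridSub L M β (2 * (2 * M))) (((q', σ'), 0) : GridLeg (GridPoint L (2 * (2 * M)))) ((p', σ'), 1) *
                    (contr ℂ ((hubbardGridSub L M β (2 * (2 * M))).transpose * hubbardCovAboveCT L M β μ 0 0 klE0 *
                        hubbardGridSub L M β (2 * (2 * M))) (((p', σ'.rev), 0) : GridLeg (GridPoint L (2 * (2 * M)))) ((q', σ'.rev), 1) *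
                      contr ℂ ((hubbardGridSub L M β (2 * (2 * M))).transpose * hubbardCovAboveCT L M β μ 0 0 klE0 *
                        hubbardGridSub L M β (2 * (2 * M))) (((q', σ'.rev), 0) : GridLeg (GridPoint L (2 * (2 * M)))) ((p', σ'.rev), 1)))))) •
                (gen ℂ (((p', σ'), 0) : GridLeg (GridPoint L (2 * (2 * M)))) * gen ℂ (((q', σ'), 1) : GridLeg (GridPoint L (2 * (2 * M))))))) ((omega0 M).rev, pp) σσ).re)) / 4))
            (WithLp.toLp 2 (klFermiPoint μ 0 θ))) θ| ≤ sS k * U ^ 2)) :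
    ∀ (P : SplitConsts) (R : RenConsts) (c : ℝ), P.WF → R.WF2 → 0 < c → c ≤ klEngC₃7GU G P R →
      ∀ μ ∈ klWindowC, ∀ U : ℝ, 0 < U → U ≤ klEngU₀12GQ G Q P R c → ∀ β : ℝ, klBetaMin ≤ β → β ≤ Real.exp (c / U ^ 2) →
        ∀ (L M : ℕ) [NeZero L] [NeZero M], klEngL₄ P R β U ≤ L → klEngM₃ β U L ≤ M →
          TwoLegReadJetBound L M klC4aJetC2 (klC4aJetC' P R) β U μ (klFlowFrameU L M β U μ 0) 0 ∧
            TwoLegReadOscAt L M (klReadOscC P R) β U μ (klFlowFrameU L M β U μ 0) 0 := by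
  intro P R c _ _ _ _ μ hμ U hU hU12 β hβ _ L M _ _ hL hM
  have hUb : U ≤ klTailBookU := hU12.trans (klEngU₀12GQ_le_klTailBookU G Q P R c)
  have hL3 : klEngL₃ β U ≤ L := klEngL₃_le_of_klEngL₄_le hL
  obtain ⟨bS, sS, hfit, hS12, hSjet⟩ := hrec μ U β L M hμ hU hUb hβ hL3 hM
  exact twoLegRead_frameZero_registered_of_records_certA (L := L) (M := M) P R hA hβ hμ hU hUb hL3 hM hS12 hSjet hfit

end Summit.HubbardSuperconductivity.HubbardSuperconductivity.Theorems.KLRegimeSplit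

end
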